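import Literature.MathematicalPhysics.QuantumFieldTheory.QCDOS
import HarnessLib

/-!
# Sketch — crux-ideate stmt-QuantumFields-11513 (`PauliWegnerSea.OneScaleTrajectory`), ideator 1

First lemmas of the idea cards in `Ideas/`, stated over existing declarations so that they
elaborate (they are NOT proved here; crux-ideate files no skeleton).

Card `laplacian-gate-feshbach`: the Cartesian split `D_W = (m₀ + W) + K` of the `r = 1`
Wilson–Dirac operator, `W = -½ Δ_U ⊗ 1_spin ≥ 0` the covariant Wilson Laplacian (Hermitian part),
`K = ½ Σ_μ γ_μ ⊗ (U_μ T_μ - h.c.)` (anti-Hermitian part); coercivity of every compression of `D_W`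
to a high spectral subspace of `W`; positivity of the determinant of such a compression
(γ₅-Hermitian + accretive ⇒ `det > 0`), so that the sign and the zeros of `det D_W` live in the
Feshbach–Schur operator on the LOW covariant-Laplacian sector; and the background-uniform Weyl
bound on the dimension of that sector (diamagnetic domination of the heat trace).
-/

namespace Summit.QuantumFields.QCD.Cruxes.OneScaleTrajectory.LaplacianGate

open Literature.MathematicalPhysics.QuantumLattice Literature.MathematicalPhysics.QuantumFieldTheory
  Literature.Probability.LatticeModels Matrix
open scoped ComplexOrder

/-- (a) CARTESIAN SPLIT. For every unitary colour representation, every background and every bare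
mass, the Hermitian part of the `r = 1` Wilson–Dirac operator minus the bare mass is positive
semidefinite: `D_W + D_Wᴴ - 2m·1 = -Δ_U ⊗ 1_spin ≥ 0` (each direction contributes
`2·1 - (V + V⁻¹)`, `V = U_μ T_μ` unitary). Hence `Re ⟪ψ, D_W ψ⟫ = m‖ψ‖² + ⟪ψ, W ψ⟫ ≥ m ‖ψ‖²`, and
on any subspace where `W ≥ Λ` the compression of `D_W` is accretive with margin `m + Λ`. -/
def CartesianSplit : Prop :=
  ∀ (L N : ℕ) [NeZero L] (G : Type) [Group G] (ρ : G →* Matrix (Fin N) (Fin N) ℂ),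
    (∀ g, ρ g ∈ Matrix.unitaryGroup (Fin N) ℂ) →
    ∀ (U : GaugeConfig 4 L G) (m : ℝ),
      (wilsonDirac ρ U m 1 + (wilsonDirac ρ U m 1)ᴴ -
        ((2 * m : ℝ) : ℂ) • (1 : Matrix (TorusSite 4 L × Fin N × Fin 4) (TorusSite 4 L × Fin N × Fin 4) ℂ)).PosSemidef

/-- (b) SIGN LOCALISATION (abstract Feshbach half). A `Γ`-Hermitian matrix (`Γ² = 1`,
`Γ A Γ = Aᴴ` — for `D_W` and all its `W`-spectral compressions, `Γ = γ₅`, which commutes with `W`)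
whose Hermitian part is positive definite has REAL, POSITIVE determinant (homotopy
`t ↦ ½(A + Aᴴ) + t·½(A - Aᴴ)` stays `Γ`-Hermitian and accretive, so `det` is real and never
vanishes). With the Schur formula `det D_W = det(Q D_W Q|_Q) · det 𝔖`, `𝔖` the Feshbach–Schur
operator on the low sector `P = 1 - Q = 1_{[0,Λ]}(W)`, `Λ > -m`, this puts `sign det D_W`, every
zero of `det D_W` and the whole non-Gibbsian part of `|det D_W|` into `det 𝔖`. -/
def AccretiveGammaHermitianDetPos : Prop :=
  ∀ (n : Type) [Fintype n] [DecidableEq n] (A Γ : Matrix n n ℂ),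
    Γ * Γ = 1 → Γ * A * Γ = Aᴴ → (A + Aᴴ).PosDef → (A.det).im = 0 ∧ 0 < (A.det).re

/-- (c) ZERO MODES ARE LAPLACIAN-CRITICAL. Every kernel vector of `D_W(U, m)` is isotropic for the
Hermitian part: with (a), `⟪ψ, W ψ⟫ = -m ‖ψ‖²` exactly — real-mode crossings at bare mass `m < 0`
are carried by fields of covariant-Laplacian energy `|m|` (covariant scale `(2|m|)^{-1/2}`), and
there are none for `m > 0`. -/
def ZeroModesLaplacianCritical : Prop :=
  ∀ (L N : ℕ) [NeZero L] (G : Type) [Group G] (ρ : G →* Matrix (Fin N) (Fin N) ℂ)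
    (U : GaugeConfig 4 L G) (m : ℝ) (ψ : TorusSite 4 L × Fin N × Fin 4 → ℂ),
    (wilsonDirac ρ U m 1).mulVec ψ = 0 →
      star ψ ⬝ᵥ (wilsonDirac ρ U m 1 + (wilsonDirac ρ U m 1)ᴴ).mulVec ψ = 0

/-- (d) FIRST LEMMA of card `laplacian-gate-feshbach` — BACKGROUND-UNIFORM WEYL BOUND FOR THE
COVARIANT WILSON LAPLACIAN. There is an absolute `C` such that for every torus side `L`, every
`SU(3)` background `U`, every bare mass `m` and every `Λ > 0`, the Hermitian part
`H = D_W + D_Wᴴ - 2m = 2W` has at most `C (1 + Λ L²)²` eigenvalues `≤ 2Λ` (i.e. `W` has at most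
that many eigenvalues `≤ Λ`): the low covariant-Laplacian sector that carries all zeros, the sign
and the in-gap modes of `D_W` has dimension `≤ C Λ² · L⁴` for `Λ ≥ L⁻²`, uniformly in the gauge
field — density `≲ m_crit(k)² ≍ g₀⁴` per site at the trajectory's window `Λ = 2|m_crit(k)|`.
Mechanism: `N(W ≤ Λ) ≤ e^{tΛ} tr e^{-tW(U)}`, diamagnetic domination
`‖(e^{-tW(U)})(x,x)‖ ≤ 3·(e^{-tW(1)})(x,x)` (path expansion of `e^{(t/2)Hop}`, unitary links), free
torus heat kernel `≤ c (t^{-2} + L^{-4})`, `t = 2/Λ`. -/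
def LaplacianWeylBound : Prop :=
  ∃ C : ℝ, 0 < C ∧ ∀ (L : ℕ) [NeZero L] (U : GaugeConfig 4 L (Matrix.specialUnitaryGroup (Fin 3) ℂ))
    (m Λ : ℝ), 0 < Λ →
    let H : Matrix (TorusSite 4 L × Fin 3 × Fin 4) (TorusSite 4 L × Fin 3 × Fin 4) ℂ :=
      wilsonDirac (fundamentalRep (Fin 3)) U m 1 + (wilsonDirac (fundamentalRep (Fin 3)) U m 1)ᴴ -
        ((2 * m : ℝ) : ℂ) • 1
    ∀ hH : H.IsHermitian,
      ((Finset.univ.filter fun i => hH.eigenvalues i ≤ 2 * Λ).card : ℝ) ≤ C * (1 + Λ * (L : ℝ) ^ 2) ^ 2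

end Summit.QuantumFields.QCD.Cruxes.OneScaleTrajectory.LaplacianGate
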